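import Summits.QuantumFields.BalabanUV.Beta.AveragingWardRootedStencils
import Literature.MathematicalPhysics.QuantumFieldTheory.Balaban1983to89.Beta.BalabanStepJets

/-!
# `BalabanUV.Beta.WardLocusStencils` — binder row D1, the WARD binder hW, leaves (W-LS0-dict) + (W-LS0-Λ): the border of the rooted
# bordered Hessian IS an1's packed averaging kernel (so its diagonal contact is the divergence of the native vh-stencil), and the Lagrange
# stencil has ZERO fine divergence

HONEST FRAMING (cell charter, verbatim): «discharging `BetaPertH` makes Bałaban's UV stability UNCONDITIONAL — a real constructive-QFT
result; it is NOT the continuum limit and NOT the Clay problem.»  DERIVED cell leaf (pub-balaban β sub-cell, D1 formalisation swarm seat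
`b2b-balaban-beta-d1-formalise-leaf-10`, on an1-g25's hW skeleton `HOME/b2b-balaban-beta-an1-g25/SKELETON-D1-hW.v1.md` §2 (W-LS)_0); every
declaration is [folklore] finite kernel algebra over objects ALREADY in the tree, cited BY NAME; no statement of Bałaban's papers is typed,
no `[cite:]` tag, no `def … : Prop`; it instantiates NO binder of the β-function wall.  NOT `BetaPertH`, NOT continuum, NOT Clay.
HONEST DEPENDENCY (cell records, verbatim): «continuum YM on T⁴ ⇐ BetaPertH ∧ nine spine estimates (0/9 proved); BetaPertH ⇐ (D1) ∧ (D4) ∧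
CAP+tail; G-an2-4 gates asym, D1 and NE2/3/4.»
ABSOLUTE RULE (cell charter, verbatim): «No internally-minted statement may enter as a cited fact. Every hypothesis is either kernel-proved in
this package or a verbatim quotation of a PUBLISHED theorem with page reference. The manuscript(s) under audit are NOT citable for their own
disputed steps — they are the thing under adjudication; programme-internal (2001/route/tribunal) claims are never citable.»

WHY.  The hW root `KernelWardRelative.wardTransversal_flipK_hessKer_conj_rel` (an1-g25) / `SpineRooted.wardTransversal_flipK_TbalOf_JsBalBmNAtOf_ctrC_kernel`
(an2-g15, p208276) carries the socket
  `hSd : ∀ y, cH • Σ_{v ∈ box} divV J.S (N•y + v) = conjV 𝕄 (X y)`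
(«the first-order stencil contracted with the block pure-gauge mode is the 𝕄-commutator of the block rotation generator»).  At `j = 0` the
stencil is an2's rooted native spine `S0NAt ρ cE cVH cΛ = cE • wilsonA + cVH • vhSAt ρ + cΛ • SLam (lamCoeffOf (KInv Lc) Lc) (hessFFAt ρ Lc)`,
`𝕄₀ = bhKAt d ρ Lc` (p204639) and the generator is DIAGONAL, `X y = diagK (ξ • Σ_v legInd ρ (N•y + v))`.  This file proves:
* §1 (W-LS0-dict) THE BORDER DICTIONARY: the field–multiplier blocks of `bhKAt d ρ L` are `∓ L^{d+1}` times an1's symmetrically packed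
  first-order averaging kernel `linSymAt ρ L` (`bhKAt_inl_inr_eq_linSymAt`, `bhKAt_inr_inl_eq_linSymAt`), hence for EVERY diagonal generator
  `conjV (bhKAt d ρ L) (diagK g) = conjV (ffK (bhKAt d ρ L)) (diagK g) − L^{d+1} • conjV (mfNeg (linSymAt ρ L)) (diagK g)` and, with an1's
  raw-placement law `divV_vhSAt_eq_conjV` (p205603's node 8ρ), **`conjV (bhKAt d ρ L) (diagK (legInd ρ u)) = conjV (ffK (bhKAt d ρ L)) (diagK (legInd ρ u))
  − L^{d+1} • divV (vhSAt ρ d L) u`** — the vh-sector of the generator's commutator IS the divergence of the NATIVE vh-stencil, scale `−L^{d+1}`;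
* §2 (W-LS0-Λ) Λ-NULL, POINTWISE: the multiplier-response coefficients have zero fine divergence,
  `Σ_κ′ (lamCoeffOf A N μ y κ′ (u − e_κ′) − lamCoeffOf A N μ y κ′ u) = 0` for EVERY kernel `A` (`d*d ∘ d = 0` on the flat Wilson column:
  `AffineAveraging.curv_dz`), hence `divV (SLam N (lamCoeffOf A N) Q2) u = 0` for decaying `A` and localised `Q2` (the block-contracted form
  asked by the skeleton follows a fortiori);
* §3 (W-LS0-lock) — the reduction of `hSd` for `S0NAt` to the Wilson sector and the scalar lock — is the sequel module
  `Summits/QuantumFields/BalabanUV/Beta/WardLocusS0N.lean` (imports this one).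
Nothing here asserts the Wilson Ward law; nothing printed is a hypothesis.
-/

noncomputable section

open Finset
open scoped BigOperators
open Literature.Probability.LatticeModels (Torus.proj)
open Literature.MathematicalPhysics.QuantumFieldTheory
open Literature.MathematicalPhysics.QuantumFieldTheory.Balaban1983to89
open Literature.MathematicalPhysics.QuantumFieldTheory.Balaban1983to89.Beta
open B12Sec2to5 (l1 l1_nonneg)
open ExpKernelCalculus (MKer Decays BiLoc VertexFamily comp)
open OneStepResolventKernel (Fib wsum summable_wsumTerm)
open KernelWard (divV)
open StepJetData (mfNeg mfNeg_inl_inl mfNeg_inl_inr mfNeg_inr_inl mfNeg_inr_inr wilsonA)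
open AffineAveraging (box toSite Form0 Form1 Form2 dz curv curvAdj curv_dz)
open AveragingContours (blk off)
open AveragingHessianKernelsRooted (vhSAt linKerAt hessFFAt)
open AveragingWardStencils (b6UnitVec_eq)
open InterLevelTransport (SLam cwsum cwsum_apply onLat)
open BalabanStepJets (lamCoeffOf elCol bondDelta box1 mem_box1 elCol_eq_zero_of_not_mem_box1)
open Summit.QuantumFields.BalabanUV.Beta.ChartConjugation (conjV)
open Summit.QuantumFields.BalabanUV.Beta.BorderedHessian (bhK bhKAt bhKAt_inl_inl bhKAt_inl_inr bhKAt_inr_inl bhKAt_inr_inr diagK diagK_apply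
  conjV_diagK_apply off_eq_zero_iff_proj blk_eq_quo linAvgAt_delta1_eq_pow_mul_linKerAt)
open Summit.QuantumFields.BalabanUV.Beta.AveragingWardRootedStencils (linSymAt linSymAt_inl_inr linSymAt_inr_inl linSymAt_inl_inl
  linSymAt_inr_inr legInd legInd_inl legInd_inr divV_vhSAt_apply)

namespace Summit.QuantumFields.BalabanUV.Beta.WardLocusStencils

variable {d : ℕ}

/-! ## §0 Small kernel algebra: the field–field part of a packed kernel; `divV` entrywise -/

/-- [folklore] THE FIELD–FIELD PART of a kernel on the packed fibre: keep the `(inl, inl)` block, zero the three others. -/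
def ffK (K : MKer (d + 1) (Fib d)) : MKer (d + 1) (Fib d) := fun x z a b =>
  match a, b with
  | Sum.inl α, Sum.inl β => K x z (Sum.inl α) (Sum.inl β)
  | Sum.inl _, Sum.inr _ => 0
  | Sum.inr _, Sum.inl _ => 0
  | Sum.inr _, Sum.inr _ => 0

/-- [folklore] `ffK` on the field–field block. -/
@[simp] theorem ffK_inl_inl (K : MKer (d + 1) (Fib d)) (x z : Fin (d + 1) → ℤ) (α β : Fin (d + 1)) :
    ffK K x z (Sum.inl α) (Sum.inl β) = K x z (Sum.inl α) (Sum.inl β) := rfl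

/-- [folklore] `ffK` vanishes on the field–multiplier block. -/
@[simp] theorem ffK_inl_inr (K : MKer (d + 1) (Fib d)) (x z : Fin (d + 1) → ℤ) (α μ : Fin (d + 1)) :
    ffK K x z (Sum.inl α) (Sum.inr μ) = 0 := rfl

/-- [folklore] `ffK` vanishes on the multiplier–field block. -/
@[simp] theorem ffK_inr_inl (K : MKer (d + 1) (Fib d)) (x z : Fin (d + 1) → ℤ) (μ α : Fin (d + 1)) :
    ffK K x z (Sum.inr μ) (Sum.inl α) = 0 := rfl

/-- [folklore] `ffK` vanishes on the multiplier–multiplier block. -/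
@[simp] theorem ffK_inr_inr (K : MKer (d + 1) (Fib d)) (x z : Fin (d + 1) → ℤ) (μ ν : Fin (d + 1)) :
    ffK K x z (Sum.inr μ) (Sum.inr ν) = 0 := rfl

/-- [folklore] The field–field part of the ROOTED bordered Hessian is that of the straight one (the root only moves the border). -/
theorem ffK_bhKAt (ρ : Fin (d + 1) → ℤ) (L : ℕ) : ffK (bhKAt d ρ L) = ffK (bhK (d := d) L) := by
  funext x z a b
  rcases a with α | μ <;> rcases b with β | ν <;> rfl

/-- [folklore] `divV` entrywise. -/
theorem divV_apply {D : ℕ} {F : Type*} [Fintype F] (V : Fin D → (Fin D → ℤ) → MKer D F) (y x z : Fin D → ℤ) (a b : F) :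
    divV V y x z a b = ∑ μ, (V μ (y - B6BondElimination.unitVec μ) x z a b - V μ y x z a b) := by
  simp only [KernelWard.divV, Finset.sum_apply, Pi.sub_apply]

/-! ## §1 (W-LS0-dict) The border of the rooted bordered Hessian is an1's packed first-order averaging kernel -/

section Dictionary

variable (ρ : Fin (d + 1) → ℤ) (L : ℕ) [NeZero L]

/-- [folklore] **FIELD–MULTIPLIER BLOCK**: `bhKAt d ρ L ((x, inl κ), (z, inr l)) = −L^{d+1} · linSymAt ρ L ((x, inl κ), (z, inr l))`
(`linAvgAt ρ (delta1 κ x) L l (z/L) = L^{d+1}·q¹,ρ`, an2's `linAvgAt_delta1_eq_pow_mul_linKerAt`; `proj = 0 ↔ off = 0`, `quo = blk`). -/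
theorem bhKAt_inl_inr_eq_linSymAt (x z : Fin (d + 1) → ℤ) (κ l : Fin (d + 1)) :
    bhKAt d ρ L x z (Sum.inl κ) (Sum.inr l) = -((L : ℝ) ^ (d + 1)) * linSymAt ρ L x z (Sum.inl κ) (Sum.inr l) := by
  rw [bhKAt_inl_inr, linSymAt_inl_inr]
  by_cases hz : off L z = 0
  · have hz' : Torus.proj L z = 0 := (off_eq_zero_iff_proj z).1 hz
    rw [if_pos hz', if_pos hz, linAvgAt_delta1_eq_pow_mul_linKerAt, ← blk_eq_quo]
    ring
  · have hz' : ¬ Torus.proj L z = 0 := fun h => hz ((off_eq_zero_iff_proj z).2 h)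
    rw [if_neg hz', if_neg hz, mul_zero]

/-- [folklore] **MULTIPLIER–FIELD BLOCK**: `bhKAt d ρ L ((x, inr κ), (z, inl l)) = +L^{d+1} · linSymAt ρ L ((x, inr κ), (z, inl l))`. -/
theorem bhKAt_inr_inl_eq_linSymAt (x z : Fin (d + 1) → ℤ) (κ l : Fin (d + 1)) :
    bhKAt d ρ L x z (Sum.inr κ) (Sum.inl l) = (L : ℝ) ^ (d + 1) * linSymAt ρ L x z (Sum.inr κ) (Sum.inl l) := by
  rw [bhKAt_inr_inl, linSymAt_inr_inl]
  by_cases hx : off L x = 0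
  · have hx' : Torus.proj L x = 0 := (off_eq_zero_iff_proj x).1 hx
    rw [if_pos hx', if_pos hx, linAvgAt_delta1_eq_pow_mul_linKerAt, ← blk_eq_quo]
  · have hx' : ¬ Torus.proj L x = 0 := fun h => hx ((off_eq_zero_iff_proj x).2 h)
    rw [if_neg hx', if_neg hx, mul_zero]

/-- [folklore] **THE BORDER DICTIONARY, KERNEL FORM**: `bhKAt d ρ L = ffK (bhKAt d ρ L) − L^{d+1} • mfNeg (linSymAt ρ L)` — the rooted
bordered Hessian is its `d*d`-window plus `−L^{d+1}` times the ANTISYMMETRICALLY placed (`mfNeg`) packed rooted averaging kernel of an1. -/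
theorem bhKAt_eq_ffK_sub_smul_mfNeg_linSymAt :
    bhKAt d ρ L = ffK (bhKAt d ρ L) - ((L : ℝ) ^ (d + 1)) • mfNeg (linSymAt ρ L) := by
  funext x z a b
  simp only [Pi.sub_apply, Pi.smul_apply, smul_eq_mul]
  rcases a with κ | κ <;> rcases b with l | l
  · rw [ffK_inl_inl, mfNeg_inl_inl, linSymAt_inl_inl]; ring
  · rw [ffK_inl_inr, mfNeg_inl_inr, bhKAt_inl_inr_eq_linSymAt]; ring
  · rw [ffK_inr_inl, mfNeg_inr_inl, bhKAt_inr_inl_eq_linSymAt]; ring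
  · rw [ffK_inr_inr, mfNeg_inr_inr, linSymAt_inr_inr, bhKAt_inr_inr]; ring

/-- [folklore] **THE DIAGONAL CONTACT OF THE ROOTED BORDERED HESSIAN, any symbol `g`**:
`conjV (bhKAt d ρ L) (diagK g) = conjV (ffK (bhKAt d ρ L)) (diagK g) − L^{d+1} • conjV (mfNeg (linSymAt ρ L)) (diagK g)` (entrywise
`conjV M (diagK g) = M · (g(col) − g(row))` is linear in `M`, an2's `conjV_diagK_apply`). -/
theorem conjV_bhKAt_diagK (g : (Fin (d + 1) → ℤ) → Fib d → ℝ) :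
    conjV (bhKAt d ρ L) (diagK g) =
      conjV (ffK (bhKAt d ρ L)) (diagK g) - ((L : ℝ) ^ (d + 1)) • conjV (mfNeg (linSymAt ρ L)) (diagK g) := by
  funext x z a b
  simp only [Pi.sub_apply, Pi.smul_apply, smul_eq_mul, conjV_diagK_apply]
  have h := congr_fun (congr_fun (congr_fun (congr_fun (bhKAt_eq_ffK_sub_smul_mfNeg_linSymAt (d := d) ρ L) x) z) a) b
  simp only [Pi.sub_apply, Pi.smul_apply, smul_eq_mul] at h
  rw [h]
  ring

/-- [folklore] **THE vh-SECTOR OF THE GENERATOR'S COMMUTATOR IS THE DIVERGENCE OF THE NATIVE vh-STENCIL, SCALE `−L^{d+1}`**: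
`conjV (bhKAt d ρ L) (diagK (legInd ρ u)) = conjV (ffK (bhKAt d ρ L)) (diagK (legInd ρ u)) − L^{d+1} • divV (vhSAt ρ d L) u`
(the dictionary + an1's raw-placement stencil Ward law `divV_vhSAt_eq_conjV`: with the SYMMETRIC placement carried by `S0NAt` the
generator pairs with `mfNeg linSymAt`, which is exactly the border of `bhKAt` up to `−L^{d+1}`). -/
theorem conjV_bhKAt_diagK_legInd (hL : 1 ≤ L) (u : Fin (d + 1) → ℤ) :
    conjV (bhKAt d ρ L) (diagK (legInd ρ u)) =
      conjV (ffK (bhKAt d ρ L)) (diagK (legInd ρ u)) - ((L : ℝ) ^ (d + 1)) • divV (vhSAt ρ d L) u := by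
  rw [conjV_bhKAt_diagK]
  congr 1
  funext x z a b
  simp only [Pi.smul_apply, smul_eq_mul, conjV_diagK_apply, divV_vhSAt_apply hL]
  ring

omit [NeZero L] in
/-- [folklore] The field–field contact explicitly: `conjV (ffK (bhKAt d ρ L)) (diagK (legInd ρ u))` lives on the `(inl, inl)` block and equals
`bhK L ((x,κ),(z,l)) · ([z = u] − [x = u])` there (a fluctuation leg acts at its own site). -/
theorem conjV_ffK_bhKAt_diagK_legInd_inl_inl (u x z : Fin (d + 1) → ℤ) (κ l : Fin (d + 1)) :
    conjV (ffK (bhKAt d ρ L)) (diagK (legInd ρ u)) x z (Sum.inl κ) (Sum.inl l) =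
      bhK (d := d) L x z (Sum.inl κ) (Sum.inl l) * ((if z = u then 1 else 0) - (if x = u then 1 else 0)) := by
  rw [conjV_diagK_apply, ffK_inl_inl, bhKAt_inl_inl, legInd_inl, legInd_inl]

end Dictionary

/-! ## §2 (W-LS0-Λ) Λ-NULL: the multiplier-response coefficients, hence the Lagrange stencil, have zero fine divergence -/

section Forms

variable {D : ℕ}

/-- [folklore] `curv` commutes with finite sums. -/
theorem curv_finset_sum {ι : Type*} (s : Finset ι) (A : ι → Form1 D ℝ) : curv (∑ i ∈ s, A i) = ∑ i ∈ s, curv (A i) := by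
  funext κ l x
  simp only [curv, Finset.sum_apply, Finset.sum_add_distrib, Finset.sum_sub_distrib]

/-- [folklore] `curvAdj` commutes with finite sums. -/
theorem curvAdj_finset_sum {ι : Type*} (s : Finset ι) (F : ι → Form2 D ℝ) : curvAdj (∑ i ∈ s, F i) = ∑ i ∈ s, curvAdj (F i) := by
  funext μ y
  simp only [curvAdj, Finset.sum_apply, Finset.sum_sub_distrib, Finset.sum_add_distrib]
  rw [Finset.sum_comm (s := Finset.univ) (t := s), Finset.sum_comm (s := Finset.univ) (t := s),
    Finset.sum_comm (s := Finset.univ) (t := s), Finset.sum_comm (s := Finset.univ) (t := s)]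

/-- [folklore] `curvAdj 0 = 0`. -/
theorem curvAdj_zero : curvAdj (0 : Form2 D ℝ) = 0 := by
  funext μ y
  simp [curvAdj]

/-- [folklore] `elCol` is additive over finite families of elementary 1-forms: `Σ_i c_i·elCol = curvAdj (curv (Σ_i c_i·e_{(κ_i,u_i)}))`
— in the difference form used below: `Σ_i (elCol κ_i u_i − elCol κ_i u′_i) = curvAdj (curv (Σ_i (e_{(κ_i,u_i)} − e_{(κ_i,u′_i)})))`. -/
theorem sum_elCol_sub (s : Finset (Fin D)) (u u' : Fin D → Fin D → ℤ) :
    ∑ κ ∈ s, (elCol κ (u κ) - elCol κ (u' κ)) = curvAdj (curv (∑ κ ∈ s, (bondDelta κ (u κ) - bondDelta κ (u' κ)))) := by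
  rw [curv_finset_sum, curvAdj_finset_sum]
  refine Finset.sum_congr rfl fun κ _ => ?_
  rw [AffineReproduction.curv_sub, AffineReproduction.curvAdj_sub]
  rfl

/-- [folklore] The elementary 1-forms of the bonds `(κ, u − e_κ)` minus those of `(κ, u)`, summed over `κ`, are the PURE GAUGE `d δ_u`. -/
theorem sum_bondDelta_sub_eq_dz (u : Fin D → ℤ) :
    ∑ κ : Fin D, (bondDelta κ (u - AffineAveraging.unitVec κ) - bondDelta κ u) =
      dz (fun z : Fin D → ℤ => if z = u then (1 : ℝ) else 0) := by
  funext l z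
  simp only [Finset.sum_apply, Pi.sub_apply, bondDelta, dz]
  rw [Finset.sum_sub_distrib, Finset.sum_eq_single l (fun κ _ hκ => by rw [if_neg (fun h => hκ h.1.symm)])
      (fun h => absurd (Finset.mem_univ l) h),
    Finset.sum_eq_single l (fun κ _ hκ => by rw [if_neg (fun h => hκ h.1.symm)]) (fun h => absurd (Finset.mem_univ l) h)]
  simp only [true_and, eq_sub_iff_add_eq]

/-- [folklore] **KEY (`d*d ∘ d = 0` on a column)**: the flat Wilson column has ZERO fine divergence in its bond index:
`Σ_κ′ (elCol κ′ (u − e_κ′) α w − elCol κ′ u α w) = 0` for every `u, α, w` (`AffineAveraging.curv_dz`). -/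
theorem sum_elCol_div_eq_zero (u : Fin D → ℤ) (α : Fin D) (w : Fin D → ℤ) :
    ∑ κ' : Fin D, (elCol κ' (u - AffineAveraging.unitVec κ') α w - elCol κ' u α w) = 0 := by
  have h := sum_elCol_sub (Finset.univ : Finset (Fin D)) (fun κ => u - AffineAveraging.unitVec κ) (fun _ => u)
  rw [sum_bondDelta_sub_eq_dz, curv_dz, curvAdj_zero] at h
  have h' := congr_fun (congr_fun h α) w
  simpa only [Finset.sum_apply, Pi.sub_apply, Pi.zero_apply] using h'

end Forms

section LambdaNull

variable {N : ℕ}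

/-- [folklore] The big box `{w : |w_i − u_i| ≤ 2}` containing the supports of the columns of all bonds within one step of `u`. -/
def box2At (u : Fin (d + 1) → ℤ) : Finset (Fin (d + 1) → ℤ) := Fintype.piFinset fun i => Finset.Icc (u i - 2) (u i + 2)

/-- [folklore] Membership in the big box. -/
theorem mem_box2At {u w : Fin (d + 1) → ℤ} : w ∈ box2At u ↔ ∀ i, u i - 2 ≤ w i ∧ w i ≤ u i + 2 := by
  simp [box2At, Fintype.mem_piFinset]

/-- [folklore] THE COEFFICIENT OVER A FIXED BOX: if `u′` is within one step of `u` (coordinatewise), the defining sum of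
`lamCoeffOf A N μ y κ′ u′` may be taken over the fixed big box around `u` (the column vanishes outside `u′ + box1`,
`elCol_eq_zero_of_not_mem_box1`). -/
theorem lamCoeffOf_eq_sum_box2At (A : MKer (d + 1) (Fib d)) (N : ℕ) (μ : Fin (d + 1)) (y : Fin (d + 1) → ℤ) (κ' : Fin (d + 1))
    {u u' : Fin (d + 1) → ℤ} (hu : ∀ i, |u' i - u i| ≤ 1) :
    lamCoeffOf A N μ y κ' u' = ∑ w ∈ box2At u, ∑ α : Fin (d + 1), A ((N : ℤ) • y) w (Sum.inr μ) (Sum.inl α) * elCol κ' u' α w := by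
  unfold lamCoeffOf
  have hinj : Set.InjOn (fun v : Fin (d + 1) → ℤ => u' + v) (box1 (d + 1) : Set (Fin (d + 1) → ℤ)) :=
    fun v _ v' _ h => add_left_cancel h
  set F : (Fin (d + 1) → ℤ) → ℝ := fun w => ∑ α : Fin (d + 1), A ((N : ℤ) • y) w (Sum.inr μ) (Sum.inl α) * elCol κ' u' α w
    with hF
  change ∑ v ∈ box1 (d + 1), F (u' + v) = ∑ w ∈ box2At u, F w
  rw [← Finset.sum_image (f := F) hinj]
  refine Finset.sum_subset (fun w hw => ?_) (fun w _ hw => ?_)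
  · rw [Finset.mem_image] at hw
    obtain ⟨v, hv, rfl⟩ := hw
    rw [mem_box1] at hv
    rw [mem_box2At]
    intro i
    have h1 := hu i
    rw [abs_le] at h1
    rcases hv i with h | h | h <;> simp only [Pi.add_apply, h] <;> constructor <;> omega
  · have hv : w - u' ∉ box1 (d + 1) := by
      intro hv
      apply hw
      rw [Finset.mem_image]
      exact ⟨w - u', hv, by abel⟩
    refine Finset.sum_eq_zero fun α _ => ?_
    have h0 := elCol_eq_zero_of_not_mem_box1 (κ' := κ') (u := u') (α := α) hv
    rw [show u' + (w - u') = w by abel] at h0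
    rw [h0, mul_zero]

/-- [folklore] **(W-LS0-Λ) FOR THE COEFFICIENTS, POINTWISE, ANY KERNEL `A`**: the multiplier response to a PURE-GAUGE fine perturbation
vanishes — `Σ_κ′ (lamCoeffOf A N μ y κ′ (u − e_κ′) − lamCoeffOf A N μ y κ′ u) = 0` (`c = ℋ♭ ∘ E″(1)` and `E″(1) ∘ d = d*d ∘ d = 0`). -/
theorem sum_lamCoeffOf_div_eq_zero (A : MKer (d + 1) (Fib d)) (N : ℕ) (μ : Fin (d + 1)) (y u : Fin (d + 1) → ℤ) :
    ∑ κ' : Fin (d + 1), (lamCoeffOf A N μ y κ' (u - AffineAveraging.unitVec κ') - lamCoeffOf A N μ y κ' u) = 0 := by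
  have h0 : ∀ i, |u i - u i| ≤ 1 := fun i => by simp
  have h1 : ∀ κ' : Fin (d + 1), ∀ i, |(u - AffineAveraging.unitVec κ') i - u i| ≤ 1 := by
    intro κ' i
    simp only [Pi.sub_apply, AffineAveraging.unitVec_apply]
    split_ifs <;> simp
  simp only [fun κ' => lamCoeffOf_eq_sum_box2At A N μ y κ' (h1 κ'), lamCoeffOf_eq_sum_box2At A N μ y _ h0,
    ← Finset.sum_sub_distrib, ← mul_sub]
  rw [Finset.sum_comm]
  refine Finset.sum_eq_zero fun w _ => ?_
  rw [Finset.sum_comm]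
  refine Finset.sum_eq_zero fun α _ => ?_
  rw [← Finset.mul_sum, sum_elCol_div_eq_zero, mul_zero]

/-- [folklore] Summability of the coarse superposition series of `SLam` at one entry (decaying coefficients, localised second jets;
the `onLat` re-indexing of `InterLevelTransport.biLoc_cwsum` / `OneStepResolventKernel.summable_wsumTerm`). -/
theorem summable_lamCoeff_mul [NeZero N] {c : Fin (d + 1) → (Fin (d + 1) → ℤ) → Fin (d + 1) → (Fin (d + 1) → ℤ) → ℝ}
    {Q2 : Fin (d + 1) → (Fin (d + 1) → ℤ) → MKer (d + 1) (Fib d)} {C Cq δ : ℝ}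
    (hc : ∀ μ y κ' u, |c μ y κ' u| ≤ C * Real.exp (-δ * l1 ((N : ℤ) • y - u))) (hQ : VertexFamily Q2 N Cq δ) (hδ : 0 < δ)
    (hC : 0 ≤ C) (μ κ' : Fin (d + 1)) (u x z : Fin (d + 1) → ℤ) (a b : Fib d) :
    Summable fun y : Fin (d + 1) → ℤ => c μ y κ' u * Q2 μ y x z a b := by
  have hCq : 0 ≤ Cq := (hQ μ 0).nonneg (Sum.inl 0)
  have hw : ∀ v, |onLat N (fun y => c μ y κ' u) v| ≤ C * Real.exp (-δ * l1 (v - u)) := by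
    intro v
    by_cases hv : Torus.proj N v = 0
    · have e := OneStepResolventKernel.eq_zsmul_quo_of_proj (N := N) hv
      simp only [onLat, hv, if_true]
      have h := hc μ (LatticeForm.quo N v) κ' u
      rwa [← e] at h
    · rw [InterLevelTransport.onLat_off _ hv, abs_zero]; positivity
  have hK : ∀ v, BiLoc (onLat N (Q2 μ) v) v v Cq δ := by
    intro v
    by_cases hv : Torus.proj N v = 0
    · have e := OneStepResolventKernel.eq_zsmul_quo_of_proj (N := N) hv
      simp only [onLat, hv, if_true]
      have h := hQ μ (LatticeForm.quo N v)
      rwa [← e] at h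
    · intro x' z' a' b'
      rw [InterLevelTransport.onLat_off _ hv]
      show |(0 : ℝ)| ≤ _
      rw [abs_zero]; positivity
  have hs := summable_wsumTerm hw hK hδ hC x z a b
  have hinj : Function.Injective (fun y : Fin (d + 1) → ℤ => (N : ℤ) • y) := by
    intro y y' h
    have := congrArg (LatticeForm.quo N) h
    simpa only [OneStepResolventKernel.quo_zsmul] using this
  have h2 := hs.comp_injective hinj
  refine h2.congr fun y => ?_
  simp only [Function.comp, InterLevelTransport.onLat_zsmul]

/-- [folklore] **(W-LS0-Λ) FOR THE STENCIL, POINTWISE**: `divV (SLam N (lamCoeffOf A N) Q2) u = 0` for every fine site `u`, every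
decaying packed kernel `A` (blocking `N`) and every second-jet family `Q2` localised at the coarse bonds — the Lagrange piece of the
first-order spine is INVISIBLE to every background gauge variation (not only to the block-constant ones of the skeleton's (W-LS0-Λ)). -/
theorem divV_SLam_lamCoeffOf_eq_zero [NeZero N] {A : MKer (d + 1) (Fib d)} {C δ Cq : ℝ} (hA : Decays A C δ) (hC : 0 ≤ C)
    (hδ : 0 < δ) {Q2 : Fin (d + 1) → (Fin (d + 1) → ℤ) → MKer (d + 1) (Fib d)} (hQ : VertexFamily Q2 N Cq δ)
    (u : Fin (d + 1) → ℤ) : divV (SLam N (lamCoeffOf A N) Q2) u = 0 := by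
  have hc := BalabanStepJets.abs_lamCoeffOf_le (N := N) hA hC hδ.le
  have hC' : 0 ≤ (3 : ℝ) ^ (d + 1) * ((d + 1 : ℕ) : ℝ) * (16 * ((d + 1 : ℕ) : ℝ)) * C * Real.exp (((d + 1 : ℕ) : ℝ) * δ) := by
    positivity
  have hs := summable_lamCoeff_mul (N := N) hc hQ hδ hC'
  funext x z a b
  rw [divV_apply]
  simp only [SLam, Pi.zero_apply, cwsum_apply, neg_sub_neg]
  -- goal: `Σ_κ′ (P κ′ u − P κ′ (u − e_κ′)) = 0` with `P κ′ u′ := Σ_μ Σ'_y c μ y κ′ u′ · Q2 μ y x z a b`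
  have key : ∑ κ' : Fin (d + 1), ((∑ μ, ∑' y, lamCoeffOf A N μ y κ' (u - B6BondElimination.unitVec κ') * Q2 μ y x z a b) -
      (∑ μ, ∑' y, lamCoeffOf A N μ y κ' u * Q2 μ y x z a b)) = 0 := by
    simp only [← Finset.sum_sub_distrib, b6UnitVec_eq]
    rw [Finset.sum_comm]
    refine Finset.sum_eq_zero fun μ _ => ?_
    have hsub : ∀ κ' : Fin (d + 1),
        (∑' y, lamCoeffOf A N μ y κ' (u - AffineAveraging.unitVec κ') * Q2 μ y x z a b) -
          (∑' y, lamCoeffOf A N μ y κ' u * Q2 μ y x z a b) =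
        ∑' y, (lamCoeffOf A N μ y κ' (u - AffineAveraging.unitVec κ') - lamCoeffOf A N μ y κ' u) * Q2 μ y x z a b := by
      intro κ'
      rw [← (hs μ κ' _ x z a b).tsum_sub (hs μ κ' u x z a b)]
      exact tsum_congr fun y => by ring
    simp only [hsub]
    have hs2 : ∀ κ' ∈ (Finset.univ : Finset (Fin (d + 1))), Summable fun y : Fin (d + 1) → ℤ =>
        (lamCoeffOf A N μ y κ' (u - AffineAveraging.unitVec κ') - lamCoeffOf A N μ y κ' u) * Q2 μ y x z a b :=
      fun κ' _ => ((hs μ κ' (u - AffineAveraging.unitVec κ') x z a b).sub (hs μ κ' u x z a b)).congr (fun y => by ring)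
    rw [← Summable.tsum_finsetSum hs2]
    refine (tsum_congr fun y => ?_).trans tsum_zero
    rw [← Finset.sum_mul, sum_lamCoeffOf_div_eq_zero, zero_mul]
  rw [Finset.sum_sub_distrib, sub_eq_zero] at key
  rw [Finset.sum_sub_distrib, key, sub_self]

/-- [folklore] **(W-LS0-Λ) IN THE SKELETON'S BLOCK-CONTRACTED FORM** (a fortiori). -/
theorem sum_divV_SLam_lamCoeffOf_eq_zero [NeZero N] {A : MKer (d + 1) (Fib d)} {C δ Cq : ℝ} (hA : Decays A C δ) (hC : 0 ≤ C)
    (hδ : 0 < δ) {Q2 : Fin (d + 1) → (Fin (d + 1) → ℤ) → MKer (d + 1) (Fib d)} (hQ : VertexFamily Q2 N Cq δ)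
    (s : Finset (Fin (d + 1) → ℤ)) : ∑ u ∈ s, divV (SLam N (lamCoeffOf A N) Q2) u = 0 :=
  Finset.sum_eq_zero fun u _ => divV_SLam_lamCoeffOf_eq_zero hA hC hδ hQ u

end LambdaNull


end Summit.QuantumFields.BalabanUV.Beta.WardLocusStencils

end
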